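import Mathlib
import Summits.AnomalousDissipation.AnomalousDissipation.Theorems.SolenoidalFractalHomogenisationLagrangianStepW7DrainFloor
import Summits.AnomalousDissipation.AnomalousDissipation.Theorems.SolenoidalFractalHomogenisationLagrangianStepCellChainRegimeTools
import Summits.AnomalousDissipation.AnomalousDissipation.Theorems.SolenoidalFractalHomogenisationLagrangianStepHighLabelDecayCoverage
import HarnessLib

/-!
# K1L_D (stmt-AnomalousDissipation-27980), W7 ENGINE (R-b) — LATTICE GEOMETRY OF THE SLOW CHAIN IN THE NEAR-CLASS REGIME
# (helper; `--supports stmt-AnomalousDissipation-27980 --as helper`)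

Discharge of the lattice hypotheses of `W7Cell.cell_slot_contraction` (p675459) for the chain `K₀ + j·K_s`, `K_s = n·m`
(`fun i => m i * n`, the cell frequency of a slot with lattice vector `m`), when `K₀` is the near representative of its Bloch class:
`2‖K₀‖ < n`, the class `K₀ + nℤ³` misses `0`.  Contents:
* §1 the cell frequency: `latticeVec_cellFreq`, `cellFreq_ne_zero'`, `chain_mem_class`;
* §2 norms along the chain: `norm_chain_ge` (`n − ‖K₀‖ ≤ ‖K₀ + jK_s‖`, `j ≠ 0`, via prover ad-k1l-cellLawV-w1 g4's
  `norm_latticeVec_ge_of_classPair_ne`), `freqNormSq_chain_ge` (`n²/4 ≤ |K₀ + jK_s|²`), `freqNormSq_chain_le` (`|K₀ ± K_s|² ≤ (25/4)n²`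
  when `|m|² ≤ 3`), `chain_ne_zero`, `freqNormSq_chain_zero`;
* §3 the drain floor in the chain's index shapes: `hqw_chain` (from `W7Slot.drain_floor_pair`) with the explicit coefficient
  `qcoef`, written out, and its bounds `γ/15 ≤ q ≤ 2` from the covering inequality `(m·K̂₀)² ≥ γ/6` (`q_chain_bounds`);
* §4 the link constant `c = |ê·K₀|(1/n)/(2|m|)`: `c_chain_bounds` (`0 < c`, `k̃²γ/216 ≤ c²` from `(v·K̂₀)² ≥ γ/3`, `|v|² = n_v ≤ 6`, `|m|² ≤ 3`);
* §5 the covering slot: `cuPoly_unpack` (from `γ ≤ cuPoly j K̂₀`: `(v_j·K̂₀)² ≥ γ/3` and `(m_j·K̂₀)² ≥ γ/6`) and the slot-data ranges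
  `slots_ranges` (`n_j ≤ 6`, `40 ≤ τ_j`, `|m_j|² ≤ 3`, by `decide`).
W7 assembly owner: prover ad-sawtooth-k1loc-p1 g11.  No definitions, no sorry.  NOT a proof of the crux / of AD; rung F-D1.A0.
[cite: BedrossianCotiZelati2017, §2 (hypocoercivity functional)] [problem: turb]
-/

set_option linter.dupNamespace false

namespace Summit.AnomalousDissipation.AnomalousDissipation.Theorems.SolenoidalFractalHomogenisation.LagrangianStep.W7Cell

open scoped InnerProductSpace
open Literature.Analysis Literature.Analysis.FunctionSpaces Literature.Analysis.FunctionSpaces.Torus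
open Literature.Analysis.FluidPDE Literature.Analysis.FluidPDE.Torus
open Summit.AnomalousDissipation.AnomalousDissipation.Theorems
open Summit.AnomalousDissipation.AnomalousDissipation.Theorems.SolenoidalFractalHomogenisation.LagrangianStep.CellChain
open Summit.AnomalousDissipation.AnomalousDissipation.Theorems.SolenoidalFractalHomogenisation.LagrangianStep.W7Slot

/-! ## §1 The cell frequency `K_s = n·m` -/

/-- `latticeVec (n·m) = n • latticeVec m`. -/
theorem latticeVec_cellFreq (m : Fin 3 → ℤ) (n : ℕ) :
    Torus.latticeVec (fun i => m i * (n : ℤ)) = (n : ℝ) • Torus.latticeVec m := by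
  ext a
  simp only [Torus.latticeVec_apply, PiLp.smul_apply, smul_eq_mul, Int.cast_mul, Int.cast_natCast]
  ring

/-- `‖n·m‖ = n‖m‖`. -/
theorem norm_cellFreq (m : Fin 3 → ℤ) (n : ℕ) :
    ‖Torus.latticeVec (fun i => m i * (n : ℤ))‖ = (n : ℝ) * ‖Torus.latticeVec m‖ := by
  rw [latticeVec_cellFreq, norm_smul, Real.norm_eq_abs, abs_of_nonneg (Nat.cast_nonneg n)]

/-- The chain `K₀ + j·(n·m)` stays in the Bloch class `K₀ + nℤ³`. -/
theorem chain_mem_class (K0 m : Fin 3 → ℤ) (n : ℕ) (j : ℤ) :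
    ∃ z : Fin 3 → ℤ, K0 + j • (fun i => m i * (n : ℤ)) = K0 + (n : ℤ) • z := by
  refine ⟨j • m, ?_⟩
  ext i
  simp only [Pi.add_apply, Pi.smul_apply, smul_eq_mul]
  ring

/-- `j·K_s ≠ 0` for `j ≠ 0`, `m ≠ 0`, `n ≥ 1`. -/
theorem zsmul_cellFreq_ne_zero {m : Fin 3 → ℤ} (hm : m ≠ 0) {n : ℕ} (hn : 1 ≤ n) {j : ℤ} (hj : j ≠ 0) :
    j • (fun i => m i * (n : ℤ)) ≠ 0 := by
  intro h
  apply hm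
  funext i
  have hi := congrFun h i
  simp only [Pi.smul_apply, smul_eq_mul, Pi.zero_apply, mul_eq_zero] at hi
  rcases hi with h1 | h1 | h1
  · exact absurd h1 hj
  · exact h1
  · exfalso; have : (1:ℤ) ≤ n := by exact_mod_cast hn
    linarith

/-! ## §2 Norms along the chain -/

/-- **Off the slow mode the chain is fast**: `n − ‖K₀‖ ≤ ‖K₀ + j·K_s‖` for `j ≠ 0` when `2‖K₀‖ < n`. -/
theorem norm_chain_ge {K0 m : Fin 3 → ℤ} {n : ℕ} (hn : 1 ≤ n) (hm : m ≠ 0) (hK0 : K0 ≠ 0)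
    (h2 : 2 * ‖Torus.latticeVec K0‖ < n) {j : ℤ} (hj : j ≠ 0) :
    (n : ℝ) - ‖Torus.latticeVec K0‖ ≤ ‖Torus.latticeVec (K0 + j • (fun i => m i * (n : ℤ)))‖ := by
  have hKs : 2 * ‖Torus.latticeVec K0‖ < ‖Torus.latticeVec (fun i => m i * (n : ℤ))‖ := by
    rw [norm_cellFreq]
    have h1 := Torus.one_le_norm_latticeVec hm
    have hn' : (0:ℝ) ≤ n := Nat.cast_nonneg n
    nlinarith
  refine norm_latticeVec_ge_of_classPair_ne (Or.inl (chain_mem_class K0 m n j)) ?_ ?_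
  · intro h
    have : j • (fun i => m i * (n : ℤ)) = 0 := by
      have := congrArg (fun x => x - K0) h
      simpa using this
    exact zsmul_cellFreq_ne_zero hm hn hj this
  · have := windows_disjoint_of_two_norm_lt hK0 hKs j 0
    simpa using this

/-- `n²/4 ≤ |K₀ + j·K_s|²` for `j ≠ 0` in the near-class regime. -/
theorem freqNormSq_chain_ge {K0 m : Fin 3 → ℤ} {n : ℕ} (hn : 1 ≤ n) (hm : m ≠ 0) (hK0 : K0 ≠ 0)
    (h2 : 2 * ‖Torus.latticeVec K0‖ < n) {j : ℤ} (hj : j ≠ 0) :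
    (n : ℝ) ^ 2 / 4 ≤ freqNormSq (K0 + j • (fun i => m i * (n : ℤ))) := by
  have h := norm_chain_ge hn hm hK0 h2 hj
  have h0 : 0 ≤ ‖Torus.latticeVec K0‖ := norm_nonneg _
  rw [← Literature.Analysis.FunctionSpaces.Torus.norm_latticeVec_sq]
  have hh : (n:ℝ) / 2 ≤ ‖Torus.latticeVec (K0 + j • (fun i => m i * (n : ℤ)))‖ := by linarith
  have : ((n:ℝ) / 2) ^ 2 ≤ ‖Torus.latticeVec (K0 + j • (fun i => m i * (n : ℤ)))‖ ^ 2 :=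
    pow_le_pow_left₀ (by positivity) hh 2
  linarith [this]

/-- `|K₀ ± K_s|² ≤ (25/4)·n²` in the near-class regime when `|m|² ≤ 3` (`‖K₀‖ + n‖m‖ ≤ n(1/2 + √3) ≤ (5/2)n`). -/
theorem freqNormSq_chain_le {K0 m : Fin 3 → ℤ} {n : ℕ} (h2 : 2 * ‖Torus.latticeVec K0‖ < n) (hm3 : freqNormSq m ≤ 3)
    {j : ℤ} (hj : j = 1 ∨ j = -1) :
    freqNormSq (K0 + j • (fun i => m i * (n : ℤ))) ≤ 25 / 4 * (n : ℝ) ^ 2 := by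
  have hn0 : (0:ℝ) ≤ n := Nat.cast_nonneg n
  have hm : ‖Torus.latticeVec m‖ ≤ 2 := by
    have hsq : ‖Torus.latticeVec m‖ ^ 2 ≤ 3 := by rw [Literature.Analysis.FunctionSpaces.Torus.norm_latticeVec_sq]; exact hm3
    nlinarith [norm_nonneg (Torus.latticeVec m)]
  have hjn : ‖Torus.latticeVec (j • (fun i => m i * (n : ℤ)))‖ = (n:ℝ) * ‖Torus.latticeVec m‖ := by
    rcases hj with rfl | rfl
    · rw [one_smul, norm_cellFreq]
    · rw [neg_one_smul, latticeVec_neg, norm_neg, norm_cellFreq]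
  have htri : ‖Torus.latticeVec (K0 + j • (fun i => m i * (n : ℤ)))‖ ≤ ‖Torus.latticeVec K0‖ + (n:ℝ) * ‖Torus.latticeVec m‖ := by
    rw [Torus.latticeVec_add, ← hjn]; exact norm_add_le _ _
  have hb : ‖Torus.latticeVec (K0 + j • (fun i => m i * (n : ℤ)))‖ ≤ 5 / 2 * (n:ℝ) := by nlinarith
  rw [← Literature.Analysis.FunctionSpaces.Torus.norm_latticeVec_sq]
  nlinarith [norm_nonneg (Torus.latticeVec (K0 + j • (fun i => m i * (n : ℤ))))]

/-- No chain vector vanishes when the class misses `0` (`L ≤ ‖K₀ + n z‖` for all `z`, `L > 0`). -/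
theorem chain_ne_zero {K0 m : Fin 3 → ℤ} {n : ℕ} {L : ℝ} (hL : 0 < L)
    (hdist : ∀ z : Fin 3 → ℤ, L ≤ ‖Torus.latticeVec (K0 + (n : ℤ) • z)‖) (j : ℤ) :
    K0 + j • (fun i => m i * (n : ℤ)) ≠ 0 := by
  obtain ⟨z, hz⟩ := chain_mem_class K0 m n j
  intro h
  have := hdist z
  rw [← hz, h, latticeVec_zero, norm_zero] at this
  linarith

/-- `|K₀ + 0·K_s|² = ‖K₀‖²`. -/
theorem freqNormSq_chain_zero (K0 m : Fin 3 → ℤ) (n : ℕ) :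
    freqNormSq (K0 + (0:ℤ) • (fun i => m i * (n : ℤ))) = ‖Torus.latticeVec K0‖ ^ 2 := by
  rw [zero_smul, add_zero, Literature.Analysis.FunctionSpaces.Torus.norm_latticeVec_sq]

/-! ## §3 The drain floor in the chain's index shapes -/

/-- **`hqw` of `cell_slot_contraction`**: for `z ⊥ K₀ + 0·K_s`,
`q‖z‖² ≤ ‖P_{K₀+1·K_s} z‖² + ‖P_{K₀+(−1)·K_s} z‖²` with the explicit `q` of `W7Slot.drain_floor_pair`. [cite: BedrossianCotiZelati2017, §2 (hypocoercivity functional)] -/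
theorem hqw_chain (K0 Ks : Fin 3 → ℤ) (z : EuclideanSpace ℂ (Fin 3)) (hz : kdot (K0 + (0:ℤ) • Ks) z = 0) :
    (2 - (freqNormSq Ks - (∑ i, (K0 i : ℝ) * Ks i) ^ 2 / freqNormSq K0)
        * (1 / freqNormSq (K0 + Ks) + 1 / freqNormSq (K0 - Ks))) * ‖z‖ ^ 2
      ≤ ‖transversalProj (K0 + (1:ℤ) • Ks) z‖ ^ 2 + ‖transversalProj (K0 + (-1:ℤ) • Ks) z‖ ^ 2 := by
  rw [zero_smul, add_zero] at hz
  rw [one_smul, neg_one_smul, ← sub_eq_add_neg]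
  exact drain_floor_pair K0 Ks hz

/-- `(‖m‖ + 1/2)² ≤ 5` for `|m|² ≤ 3`. -/
theorem norm_add_half_sq_le {m : Fin 3 → ℤ} (hm3 : freqNormSq m ≤ 3) : (‖Torus.latticeVec m‖ + 1 / 2) ^ 2 ≤ 5 := by
  have hsq : ‖Torus.latticeVec m‖ ^ 2 ≤ 3 := by rw [Literature.Analysis.FunctionSpaces.Torus.norm_latticeVec_sq]; exact hm3
  have h0 := norm_nonneg (Torus.latticeVec m)
  -- `‖m‖ ≤ 7/4` since `(7/4)² = 49/16 > 3`
  have h74 : ‖Torus.latticeVec m‖ ≤ 7 / 4 := by nlinarith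
  nlinarith

/-- **Bounds of the drain coefficient on the covering slot**: `γ/15 ≤ q ≤ 2`, from `(m·K₀)² ≥ (γ/6)‖K₀‖²`, `|m|² ≤ 3`, `2‖K₀‖ < n`.
[cite: BedrossianCotiZelati2017, §2 (hypocoercivity functional)] -/
theorem q_chain_bounds {K0 m : Fin 3 → ℤ} {n : ℕ} {γ : ℝ} (hK0 : K0 ≠ 0) (h2 : 2 * ‖Torus.latticeVec K0‖ < n)
    (hm3 : freqNormSq m ≤ 3) (hγ : 0 ≤ γ)
    (hcov : γ / 6 * ‖Torus.latticeVec K0‖ ^ 2 ≤ (∑ i, (K0 i : ℝ) * m i) ^ 2) :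
    γ / 15 ≤ 2 - (freqNormSq (fun i => m i * (n : ℤ)) - (∑ i, (K0 i : ℝ) * (fun i => m i * (n : ℤ)) i) ^ 2 / freqNormSq K0)
        * (1 / freqNormSq (K0 + (fun i => m i * (n : ℤ))) + 1 / freqNormSq (K0 - (fun i => m i * (n : ℤ)))) ∧
      2 - (freqNormSq (fun i => m i * (n : ℤ)) - (∑ i, (K0 i : ℝ) * (fun i => m i * (n : ℤ)) i) ^ 2 / freqNormSq K0)
        * (1 / freqNormSq (K0 + (fun i => m i * (n : ℤ))) + 1 / freqNormSq (K0 - (fun i => m i * (n : ℤ)))) ≤ 2 := by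
  refine ⟨?_, drain_floor_coeff_le_two K0 _⟩
  refine le_trans ?_ (drain_floor_coeff_lower hK0 _)
  -- `2(K₀·K_s)²/(‖K₀‖²(‖K_s‖ + ‖K₀‖)²) ≥ γ/15`
  set F : ℝ := freqNormSq K0 with hF
  have hFpos : 0 < F := freqNormSq_pos_of_ne_zero' hK0
  have hFeq : ‖Torus.latticeVec K0‖ ^ 2 = F := Literature.Analysis.FunctionSpaces.Torus.norm_latticeVec_sq K0
  have hK0n : ‖Torus.latticeVec K0‖ = Real.sqrt F := by
    rw [← hFeq, Real.sqrt_sq (norm_nonneg _)]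
  have hn0 : (0:ℝ) ≤ n := Nat.cast_nonneg n
  have hdot : ∑ i, (K0 i : ℝ) * (fun i => m i * (n : ℤ)) i = (n:ℝ) * ∑ i, (K0 i : ℝ) * m i := by
    rw [Finset.mul_sum]
    refine Finset.sum_congr rfl fun i _ => ?_
    push_cast; ring
  have hN : Real.sqrt (freqNormSq (fun i => m i * (n : ℤ))) = (n:ℝ) * ‖Torus.latticeVec m‖ := by
    rw [← Literature.Analysis.FunctionSpaces.Torus.norm_latticeVec_sq, Real.sqrt_sq (norm_nonneg _), norm_cellFreq]
  rw [hdot, hN, ← hK0n]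
  set κ : ℝ := ∑ i, (K0 i : ℝ) * m i with hκ
  set a : ℝ := ‖Torus.latticeVec K0‖ with ha
  set b : ℝ := ‖Torus.latticeVec m‖ with hb
  have ha0 : 0 < a := by rw [ha]; exact norm_pos_iff.2 (by
    intro h; apply hK0; have := congrArg (fun v => v) h
    funext i; have hi := congrFun (congrArg (fun (v : EuclideanSpace ℝ (Fin 3)) => (v : Fin 3 → ℝ)) h) i
    simpa [Torus.latticeVec_apply] using hi)
  have hb0 : 0 ≤ b := norm_nonneg _
  have h5 := norm_add_half_sq_le hm3
  rw [← hb] at h5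
  -- denominator: `F·(n b + a)² ≤ F·n²·(b + 1/2)² ≤ 5 F n²`
  have hden : F * ((n:ℝ) * b + a) ^ 2 ≤ 5 * F * (n:ℝ) ^ 2 := by
    have h1 : (n:ℝ) * b + a ≤ (n:ℝ) * (b + 1 / 2) := by nlinarith
    have h2 : ((n:ℝ) * b + a) ^ 2 ≤ ((n:ℝ) * (b + 1 / 2)) ^ 2 := pow_le_pow_left₀ (by positivity) h1 2
    have h3 : ((n:ℝ) * (b + 1 / 2)) ^ 2 ≤ 5 * (n:ℝ) ^ 2 := by rw [mul_pow]; nlinarith [sq_nonneg (n:ℝ)]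
    nlinarith [hFpos.le]
  by_cases hden0 : F * ((n:ℝ) * b + a) ^ 2 = 0
  · -- then `n = 0`… impossible since `2a < n`; but handle formally: the bound `γ/15 ≤ 2·(…)/0 = 0` needs `γ = 0`-free route
    have hnb : (n:ℝ) * b + a = 0 := by
      rcases mul_eq_zero.1 hden0 with h | h
      · exact absurd h hFpos.ne'
      · exact pow_eq_zero_iff two_ne_zero |>.1 h
    exfalso; nlinarith
  have hdenpos : 0 < F * ((n:ℝ) * b + a) ^ 2 := lt_of_le_of_ne (by positivity) (Ne.symm hden0)
  rw [le_div_iff₀ hdenpos]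
  -- `γ/15 · F (n b + a)² ≤ γ/15 · 5 F n² = γ F n²/3 ≤ 2 n² κ²` using `γ F/6 ≤ κ²`
  have hcov' : γ / 6 * F ≤ κ ^ 2 := by rw [← hFeq]; exact hcov
  calc γ / 15 * (F * ((n:ℝ) * b + a) ^ 2) ≤ γ / 15 * (5 * F * (n:ℝ) ^ 2) :=
        mul_le_mul_of_nonneg_left hden (by positivity)
    _ = 2 * (n:ℝ) ^ 2 * (γ / 6 * F) := by ring
    _ ≤ 2 * (n:ℝ) ^ 2 * κ ^ 2 := mul_le_mul_of_nonneg_left hcov' (by positivity)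
    _ = 2 * ((n:ℝ) * κ) ^ 2 := by ring

/-! ## §4 The link constant -/

/-- **The link constant of the covering slot**: `c = |ê·K₀|(1/n)/(2‖m‖)` with `ê = v/√n_v`:
`0 < c` and `k̃²γ/216 ≤ c²` (`k̃ = ‖K₀‖/n`) from `(v·K₀)² ≥ (γ/3)‖K₀‖²`, `1 ≤ n_v ≤ 6`, `|m|² ≤ 3`, `m ≠ 0`.
[cite: BedrossianCotiZelati2017, §2 (hypocoercivity functional)] -/
theorem c_chain_bounds {K0 m v : Fin 3 → ℤ} {n nv : ℕ} {γ c : ℝ} (hn : 1 ≤ n) (hm : m ≠ 0) (hm3 : freqNormSq m ≤ 3)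
    (hnv1 : 1 ≤ nv) (hnv6 : nv ≤ 6) (hγ : 0 < γ) (hK0 : K0 ≠ 0)
    (hcov : γ / 3 * ‖Torus.latticeVec K0‖ ^ 2 ≤ (∑ i, (v i : ℝ) * K0 i) ^ 2)
    (hc : c = |∑ a, ((1 / Real.sqrt (nv : ℝ)) • Torus.latticeVec v) a * (K0 a : ℝ)| * (1 / (n : ℝ))
      / (2 * ‖Torus.latticeVec m‖)) :
    0 < c ∧ (‖Torus.latticeVec K0‖ / n) ^ 2 * γ / 216 ≤ c ^ 2 := by
  have hn0 : (0:ℝ) < n := by exact_mod_cast hn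
  have hnv0 : (0:ℝ) < nv := by exact_mod_cast hnv1
  have hnv6' : (nv:ℝ) ≤ 6 := by exact_mod_cast hnv6
  have hmpos : 0 < ‖Torus.latticeVec m‖ := lt_of_lt_of_le one_pos (Torus.one_le_norm_latticeVec hm)
  have hm2 : ‖Torus.latticeVec m‖ ^ 2 ≤ 3 := by rw [Literature.Analysis.FunctionSpaces.Torus.norm_latticeVec_sq]; exact hm3
  have hK0pos : 0 < ‖Torus.latticeVec K0‖ ^ 2 := by
    rw [Literature.Analysis.FunctionSpaces.Torus.norm_latticeVec_sq]; exact freqNormSq_pos_of_ne_zero' hK0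
  have hsum : ∑ a, ((1 / Real.sqrt (nv : ℝ)) • Torus.latticeVec v) a * (K0 a : ℝ)
      = (1 / Real.sqrt (nv : ℝ)) * ∑ i, (v i : ℝ) * K0 i := by
    rw [Finset.mul_sum]
    refine Finset.sum_congr rfl fun a _ => ?_
    rw [PiLp.smul_apply, smul_eq_mul, Torus.latticeVec_apply]; ring
  have hθpos : 0 < (∑ i, (v i : ℝ) * K0 i) ^ 2 := lt_of_lt_of_le (by positivity) hcov
  have hθne : ∑ i, (v i : ℝ) * K0 i ≠ 0 := fun h => by rw [h] at hθpos; simp at hθpos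
  have hsq : 0 < Real.sqrt (nv : ℝ) := Real.sqrt_pos.2 hnv0
  constructor
  · rw [hc, hsum, abs_mul, abs_of_pos (by positivity : (0:ℝ) < 1 / Real.sqrt (nv:ℝ))]
    have : 0 < |∑ i, (v i : ℝ) * K0 i| := abs_pos.2 hθne
    positivity
  · have hc2 : c ^ 2 = (∑ i, (v i : ℝ) * K0 i) ^ 2 / ((nv:ℝ) * (4 * (n:ℝ) ^ 2 * ‖Torus.latticeVec m‖ ^ 2)) := by
      rw [hc, hsum]
      simp only [div_pow, mul_pow, sq_abs, one_pow, Real.sq_sqrt hnv0.le]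
      field_simp
      ring
    rw [hc2, le_div_iff₀ (by positivity)]
    -- `(k̃²γ/216)·nv·4n²‖m‖² ≤ (γ/3)‖K₀‖² ≤ (v·K₀)²`
    calc (‖Torus.latticeVec K0‖ / n) ^ 2 * γ / 216 * ((nv:ℝ) * (4 * (n:ℝ) ^ 2 * ‖Torus.latticeVec m‖ ^ 2))
        = γ * ‖Torus.latticeVec K0‖ ^ 2 * ((nv:ℝ) * ‖Torus.latticeVec m‖ ^ 2) / 54 := by
          field_simp
          ring
      _ ≤ γ * ‖Torus.latticeVec K0‖ ^ 2 * (6 * 3) / 54 := by gcongr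
      _ = γ / 3 * ‖Torus.latticeVec K0‖ ^ 2 := by ring
      _ ≤ (∑ i, (v i : ℝ) * K0 i) ^ 2 := hcov

/-! ## §5 The covering slot -/

/-- **Unpacking `γ ≤ cuPoly j K̂₀`**: with `K̂₀ = K₀/‖K₀‖`, `cuPoly j K̂₀ = (v_j·K̂₀)²(m_j·K̂₀)²`; since `(v_j·K̂₀)² ≤ n_j ≤ 6` and
`(m_j·K̂₀)² ≤ |m_j|² ≤ 3` (Cauchy–Schwarz), `γ/3·‖K₀‖² ≤ (v_j·K₀)²` and `γ/6·‖K₀‖² ≤ (m_j·K₀)²`. -/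
theorem cuPoly_unpack {K0 : Fin 3 → ℤ} (hK0 : K0 ≠ 0) {γ : ℝ} (j : Fin 26)
    (hv2 : ((slots j).v 0 : ℝ) ^ 2 + ((slots j).v 1 : ℝ) ^ 2 + ((slots j).v 2 : ℝ) ^ 2 ≤ 6)
    (hm2 : ((slots j).m 0 : ℝ) ^ 2 + ((slots j).m 1 : ℝ) ^ 2 + ((slots j).m 2 : ℝ) ^ 2 ≤ 3)
    (hcu : γ ≤ HighLabelDecay.cuPoly j ((1 / ‖Torus.latticeVec K0‖) • Torus.latticeVec K0)) :
    γ / 3 * ‖Torus.latticeVec K0‖ ^ 2 ≤ (∑ i, ((slots j).v i : ℝ) * K0 i) ^ 2 ∧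
      γ / 6 * ‖Torus.latticeVec K0‖ ^ 2 ≤ (∑ i, (K0 i : ℝ) * (slots j).m i) ^ 2 := by
  set a : ℝ := ‖Torus.latticeVec K0‖ with ha
  have hF : a ^ 2 = (K0 0 : ℝ) ^ 2 + (K0 1 : ℝ) ^ 2 + (K0 2 : ℝ) ^ 2 := by
    rw [ha, Literature.Analysis.FunctionSpaces.Torus.norm_latticeVec_sq, freqNormSq, Fin.sum_univ_three]
  have ha0 : 0 < a := by
    have : 0 < a ^ 2 := by rw [ha, Literature.Analysis.FunctionSpaces.Torus.norm_latticeVec_sq]; exact freqNormSq_pos_of_ne_zero' hK0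
    exact lt_of_le_of_ne (norm_nonneg _) (fun h => by rw [← h] at this; simp at this)
  -- the two dot products
  set V : ℝ := ((slots j).v 0 : ℝ) * K0 0 + (slots j).v 1 * K0 1 + (slots j).v 2 * K0 2 with hV
  set W : ℝ := ((slots j).m 0 : ℝ) * K0 0 + (slots j).m 1 * K0 1 + (slots j).m 2 * K0 2 with hW
  have hcu' : γ ≤ (V / a) ^ 2 * (W / a) ^ 2 := by
    have e : HighLabelDecay.cuPoly j ((1 / a) • Torus.latticeVec K0) = (V / a) ^ 2 * (W / a) ^ 2 := by
      simp only [HighLabelDecay.cuPoly, PiLp.smul_apply, smul_eq_mul, Torus.latticeVec_apply, hV, hW]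
      field_simp
    rw [ha] at e ⊢; rw [e] at hcu; exact hcu
  -- Cauchy–Schwarz: `V² ≤ 6 a²`, `W² ≤ 3 a²`
  have hCSV : V ^ 2 ≤ 6 * a ^ 2 := by
    have h := Finset.sum_mul_sq_le_sq_mul_sq Finset.univ (fun i => ((slots j).v i : ℝ)) (fun i => (K0 i : ℝ))
    simp only [Fin.sum_univ_three] at h
    rw [hV, hF]; nlinarith [h, sq_nonneg (K0 0 : ℝ), sq_nonneg (K0 1 : ℝ), sq_nonneg (K0 2 : ℝ)]
  have hCSW : W ^ 2 ≤ 3 * a ^ 2 := by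
    have h := Finset.sum_mul_sq_le_sq_mul_sq Finset.univ (fun i => ((slots j).m i : ℝ)) (fun i => (K0 i : ℝ))
    simp only [Fin.sum_univ_three] at h
    rw [hW, hF]; nlinarith [h, sq_nonneg (K0 0 : ℝ), sq_nonneg (K0 1 : ℝ), sq_nonneg (K0 2 : ℝ)]
  have ha2 : 0 < a ^ 2 := by positivity
  have hprod : γ * a ^ 2 * a ^ 2 ≤ V ^ 2 * W ^ 2 := by
    have := hcu'
    rw [div_pow, div_pow, div_mul_div_comm, le_div_iff₀ (by positivity)] at this
    linarith
  have hsumV : ∑ i, ((slots j).v i : ℝ) * K0 i = V := by rw [hV, Fin.sum_univ_three]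
  have hsumW : ∑ i, (K0 i : ℝ) * (slots j).m i = W := by rw [hW, Fin.sum_univ_three]; ring
  rw [hsumV, hsumW]
  constructor
  · -- `γ a⁴ ≤ V² W² ≤ V² · 3a²`
    have h0 : γ * a ^ 2 * a ^ 2 ≤ V ^ 2 * (3 * a ^ 2) := hprod.trans (mul_le_mul_of_nonneg_left hCSW (sq_nonneg V))
    have h1 : a ^ 2 * (γ * a ^ 2) ≤ a ^ 2 * (3 * V ^ 2) := by
      calc a ^ 2 * (γ * a ^ 2) = γ * a ^ 2 * a ^ 2 := by ring
        _ ≤ V ^ 2 * (3 * a ^ 2) := h0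
        _ = a ^ 2 * (3 * V ^ 2) := by ring
    have h2 := le_of_mul_le_mul_left h1 ha2
    linarith
  · have h0 : γ * a ^ 2 * a ^ 2 ≤ (6 * a ^ 2) * W ^ 2 := hprod.trans (mul_le_mul_of_nonneg_right hCSV (sq_nonneg W))
    have h1 : a ^ 2 * (γ * a ^ 2) ≤ a ^ 2 * (6 * W ^ 2) := by
      calc a ^ 2 * (γ * a ^ 2) = γ * a ^ 2 * a ^ 2 := by ring
        _ ≤ (6 * a ^ 2) * W ^ 2 := h0
        _ = a ^ 2 * (6 * W ^ 2) := by ring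
    have h2 := le_of_mul_le_mul_left h1 ha2
    linarith

/-- The integer ranges of the 26 slots of the cubature word: `1 ≤ n_j ≤ 6`, `40 ≤ τ_j`, `|m_j|² ≤ 3`, `|v_j|² = n_j`. -/
theorem slots_ranges (j : Fin 26) : 1 ≤ (slots j).n ∧ (slots j).n ≤ 6 ∧ 40 ≤ (slots j).τ ∧
    (slots j).m 0 ^ 2 + (slots j).m 1 ^ 2 + (slots j).m 2 ^ 2 ≤ 3 ∧
    (slots j).v 0 ^ 2 + (slots j).v 1 ^ 2 + (slots j).v 2 ^ 2 = ((slots j).n : ℤ) := by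
  revert j; decide

end Summit.AnomalousDissipation.AnomalousDissipation.Theorems.SolenoidalFractalHomogenisation.LagrangianStep.W7Cell
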